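import Literature.Computability.QuantumComplexity.PathModelGadgetTransport
import Literature.Computability.QuantumComplexity.PathModelEncodedIntertwiners
import HarnessLib

/-!
# The two-qubit gadgets as approximate intertwiners of controlled phase gates

Topic `Literature/Computability/QuantumComplexity`; sequel of `PathModelGadgetTransport.lean`.
For a word `g` in the gadget symbols with bookkeeping vector `(p, q) = piVec g ∈ K5²`, the braid
operator `bigOp a ha g` on the `4N`-strand register maps `|enc x⟩ ↦ |enc x⟩` unless
`x_a = x_{a+1} = 1`, and `|enc x⟩ ↦ p |enc x⟩ + q · spliceIso x a ℓ'` otherwise. Hence it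
intertwines the code isometry `encIso N` with the CONTROLLED PHASE gate
`ctrlPhase a u = diag(x ↦ u if x_a = x_{a+1} = 1, else 1)` up to the defect

  `‖bigOp a g · encIso - encIso · ctrlPhase a u‖ ≤ ‖p - u‖ + 4 ‖q‖`

(`norm_bigOp_mul_encIso_sub_le`, operator norms; Aharonov–Arad 2011 Claim 3.1 is the statement
that such defects add up along a circuit, here `PathModelEncodedIntertwiners`). The proof writes
the defect as `(p - u) · encIso · P + q · L` with `P` the diagonal projection onto
`{x : x_a = x_{a+1} = 1}` and `L = Σᵢ cᵢ Lᵢ`, `Lᵢ |x⟩ = |splice x a kᵢ⟩` the placements of the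
four leakage walks `kᵢ` (coefficients `cᵢ ∈ K5`, `|cᵢ|² ∈ {7φ-11, 18-11φ, 18φ-29} ⊂ (0,1)`), and
uses `Lᵢᴴ Lᵢ = P` (distinct `x` give orthogonal leakage: they differ outside the window).

## References

* D. Aharonov, I. Arad, New J. Phys. 13 (2011) 035019; arXiv:quant-ph/0605181, §3.2, Claim 3.1
  [AharonovArad2011].
-/

noncomputable section

open scoped Matrix.Norms.L2Operator

open Matrix

namespace Literature.Computability.QuantumComplexity

open Cryptography QuadraticAlgebra

namespace Gadget

variable {N : ℕ}

/-! ### The ideal gate and the pieces of the defect -/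

/-- `x_a = x_{a+1} = 1`. [folklore] -/
def Both (a : ℕ) (ha : a + 2 ≤ N) (x : QReg N) : Prop := x ⟨a, by omega⟩ = true ∧ x ⟨a + 1, by omega⟩ = true

/-- `Both` is decidable. [folklore] -/
instance (a : ℕ) (ha : a + 2 ≤ N) : DecidablePred (Both a ha) := fun _ => by unfold Both; infer_instance

/-- **The controlled phase gate** `diag(x ↦ u if x_a = x_{a+1} = 1, else 1)` on `N` qubits (for
`u = -1` this is `CZ_{a,a+1}`). [cite: AharonovArad2011, §3.2] -/
def ctrlPhase (a : ℕ) (ha : a + 2 ≤ N) (u : ℂ) : Matrix (QReg N) (QReg N) ℂ :=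
  diagonal fun x => if Both a ha x then u else 1

/-- The diagonal projection onto `{x : x_a = x_{a+1} = 1}`. [folklore] -/
def bothProj (a : ℕ) (ha : a + 2 ≤ N) : Matrix (QReg N) (QReg N) ℂ :=
  diagonal fun x => if Both a ha x then 1 else 0

/-- **Placement of a leakage walk**: column `x` is `|splice x a key⟩` if `x_a = x_{a+1} = 1`, else
`0`. [cite: AharonovArad2011, §3.2] -/
def leakCol (a : ℕ) (ha : a + 2 ≤ N) (key : QReg (2 * 4)) : Matrix (QReg (N * 4)) (QReg N) ℂ :=
  of fun r x => if Both a ha x ∧ r = splice x a key then 1 else 0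

/-- The leakage part of the defect for a sparse window vector `L`: `Σ_{(k,c) ∈ L} c • leakCol k`.
[cite: AharonovArad2011, §3.2] -/
def leakMat (a : ℕ) (ha : a + 2 ≤ N) (L : SVec (2 * 4)) : Matrix (QReg (N * 4)) (QReg N) ℂ :=
  (L.map fun t => K5.toComplex t.2 • leakCol a ha t.1).sum

/-! ### Columns -/

/-- Columns of a rectangular matrix as `mulVec` of basis states. [folklore] -/
theorem mulVec_basisState_eq_col {m : Type*} (A : Matrix m (QReg N) ℂ) (x : QReg N) :
    A *ᵥ basisState x = fun i => A i x := by
  rw [basisState, Matrix.mulVec_single_one]; rfl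

/-- Two rectangular matrices agreeing on all basis states are equal. [folklore] -/
theorem ext_of_mulVec_basisState {m : Type*} {A B : Matrix m (QReg N) ℂ}
    (h : ∀ x, A *ᵥ basisState x = B *ᵥ basisState x) : A = B := by
  ext i x
  have := congr_fun (h x) i
  rwa [mulVec_basisState_eq_col, mulVec_basisState_eq_col] at this

/-- Columns of the controlled phase gate. [folklore] -/
theorem ctrlPhase_mulVec_basisState (a : ℕ) (ha : a + 2 ≤ N) (u : ℂ) (x : QReg N) :
    ctrlPhase a ha u *ᵥ basisState x = (if Both a ha x then u else 1) • basisState x := by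
  rw [ctrlPhase, basisState, Matrix.mulVec_single_one]
  ext y
  simp only [Matrix.col_apply, diagonal_apply, Pi.smul_apply, Pi.single_apply, smul_eq_mul, mul_ite, mul_one, mul_zero]
  by_cases h : y = x
  · subst h; simp
  · rw [if_neg h, if_neg h]

/-- Columns of the projection. [folklore] -/
theorem bothProj_mulVec_basisState (a : ℕ) (ha : a + 2 ≤ N) (x : QReg N) :
    bothProj a ha *ᵥ basisState x = (if Both a ha x then (1 : ℂ) else 0) • basisState x := by
  rw [bothProj, basisState, Matrix.mulVec_single_one]
  ext y
  simp only [Matrix.col_apply, diagonal_apply, Pi.smul_apply, Pi.single_apply, smul_eq_mul, mul_ite, mul_one, mul_zero]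
  by_cases h : y = x
  · subst h; simp
  · rw [if_neg h, if_neg h]

/-- Columns of a leakage placement. [folklore] -/
theorem leakCol_mulVec_basisState (a : ℕ) (ha : a + 2 ≤ N) (key : QReg (2 * 4)) (x : QReg N) :
    leakCol a ha key *ᵥ basisState x = if Both a ha x then basisState (splice x a key) else 0 := by
  rw [mulVec_basisState_eq_col]
  funext r
  simp only [leakCol, of_apply]
  by_cases hb : Both a ha x
  · rw [if_pos hb, basisState_apply]
    by_cases hr : r = splice x a key
    · rw [if_pos ⟨hb, hr⟩, if_pos hr]
    · rw [if_neg (fun h => hr h.2), if_neg hr]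
  · rw [if_neg (fun h => hb h.1), if_neg hb]; rfl

/-- Columns of the leakage part. [folklore] -/
theorem leakMat_mulVec_basisState (a : ℕ) (ha : a + 2 ≤ N) (L : SVec (2 * 4)) (x : QReg N) :
    leakMat a ha L *ᵥ basisState x =
      if Both a ha x then (L.map fun t => K5.toComplex t.2 • basisState (splice x a t.1)).sum else 0 := by
  induction L with
  | nil => simp [leakMat]
  | cons t L ih =>
    have e : leakMat a ha (t :: L) = K5.toComplex t.2 • leakCol a ha t.1 + leakMat a ha L := by
      simp [leakMat]
    rw [e, add_mulVec, smul_mulVec, ih, leakCol_mulVec_basisState, List.map_cons, List.sum_cons]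
    split_ifs <;> simp

/-- `spliceIso` on a sparse window vector all of whose walks return to `1`. [folklore] -/
theorem spliceIso_mulVec_evalS (x : QReg N) {a : ℕ} (ha : a + 2 ≤ N) (L : SVec (2 * 4))
    (hL : ∀ t ∈ L, pathPos t.1 (2 * 4) = 1) :
    spliceIso x a 2 *ᵥ evalS L = (L.map fun t => K5.toComplex t.2 • basisState (splice x a t.1)).sum := by
  induction L with
  | nil => simp
  | cons t L ih =>
    rw [evalS_cons, mulVec_add, mulVec_smul, spliceIso_mulVec_basisState x ha,
      if_pos (hL t (by simp)), ih (fun t' ht' => hL t' (by simp [ht'])), List.map_cons, List.sum_cons]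

/-- The four leakage walks return to vertex `1`. [cite: AharonovArad2011, §3.2] -/
theorem leakS_good : ∀ t ∈ leakS, pathPos t.1 (2 * 4) = 1 := by decide

/-- **The defect, decomposed**: `bigOp · encIso - encIso · ctrlPhase u = (p - u) • encIso · P + q • L`.
[cite: AharonovArad2011, §3.2] -/
theorem bigOp_mul_encIso_sub (a : ℕ) (ha : a + 2 ≤ N) (g : List Sym) (u : ℂ) :
    bigOp a ha g * encIso N - encIso N * ctrlPhase a ha u =
      (K5.toComplex (piVec g).1 - u) • (encIso N * bothProj a ha) + K5.toComplex (piVec g).2 • leakMat a ha leakS := by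
  refine ext_of_mulVec_basisState fun x => ?_
  rw [sub_mulVec, add_mulVec, smul_mulVec, smul_mulVec, ← mulVec_mulVec, ← mulVec_mulVec, ← mulVec_mulVec,
    encIso_mulVec_basisState, ctrlPhase_mulVec_basisState, bothProj_mulVec_basisState, leakMat_mulVec_basisState,
    mulVec_smul, mulVec_smul, encIso_mulVec_basisState]
  by_cases hb : Both a ha x
  · rw [if_pos hb, if_pos hb, if_pos hb, bigOp_mulVec_basisState_encodeBits_of_both x ha g hb.1 hb.2, leak,
      spliceIso_mulVec_evalS x ha leakS leakS_good, one_smul, sub_smul]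
    abel
  · rw [if_neg hb, if_neg hb, if_neg hb, bigOp_mulVec_basisState_encodeBits_of_not x ha g hb, one_smul, sub_self,
      zero_smul, smul_zero, smul_zero, add_zero]

/-! ### Norms of the pieces -/

/-- A matrix with `Aᴴ A = A` has norm `≤ 1` (`‖A‖ = ‖Aᴴ A‖ = ‖A‖²`). [folklore] -/
theorem norm_le_one_of_conjTranspose_mul_self {A : Matrix (QReg N) (QReg N) ℂ} (h : Aᴴ * A = A) : ‖A‖ ≤ 1 := by
  have e := Matrix.l2_opNorm_conjTranspose_mul_self A
  rw [h] at e
  nlinarith [norm_nonneg A]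

/-- `Pᴴ P = P` for the diagonal `0/1` projection. [folklore] -/
theorem conjTranspose_bothProj_mul_self (a : ℕ) (ha : a + 2 ≤ N) :
    (bothProj a ha)ᴴ * bothProj a ha = bothProj (N := N) a ha := by
  rw [bothProj, diagonal_conjTranspose, diagonal_mul_diagonal]
  congr 1
  funext x
  by_cases h : Both a ha x <;> simp [Pi.star_apply, h]

/-- `‖P‖ ≤ 1`. [folklore] -/
theorem norm_bothProj_le_one (a : ℕ) (ha : a + 2 ≤ N) : ‖bothProj (N := N) a ha‖ ≤ 1 :=
  norm_le_one_of_conjTranspose_mul_self (conjTranspose_bothProj_mul_self a ha)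

/-- Code strings with `x_a = x_{a+1} = 1 = y_a = y_{a+1}` and equal splices are equal: they agree
off the window. [cite: AharonovArad2011, §3.2] -/
theorem eq_of_splice_eq {a : ℕ} (ha : a + 2 ≤ N) {x y : QReg N} (hx : Both a ha x) (hy : Both a ha y)
    {u u' : QReg (2 * 4)} (h : splice x a u = splice y a u') : x = y := by
  funext b
  by_cases h1 : (b : ℕ) = a
  · have e : b = ⟨a, by omega⟩ := Fin.ext h1
    rw [e, hx.1, hy.1]
  by_cases h2 : (b : ℕ) = a + 1
  · have e : b = ⟨a + 1, by omega⟩ := Fin.ext h2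
    rw [e, hx.2, hy.2]
  have ht : 4 * (b : ℕ) + 1 < N * 4 := by have := b.isLt; omega
  have key := congr_fun h ⟨4 * b + 1, ht⟩
  have hout : ¬(4 * a ≤ 4 * (b : ℕ) + 1 ∧ 4 * (b : ℕ) + 1 < 4 * a + 2 * 4) := by omega
  unfold splice at key
  rw [dif_neg hout, dif_neg hout, encodeBits_apply x b (r := 1) (by norm_num) _ rfl,
    encodeBits_apply y b (r := 1) (by norm_num) _ rfl, encBit_one, encBit_one] at key
  exact key

/-- **`Lᵢᴴ Lᵢ = P`**: leakage placed at distinct `x` is orthogonal. [cite: AharonovArad2011, §3.2] -/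
theorem conjTranspose_leakCol_mul_self (a : ℕ) (ha : a + 2 ≤ N) (key : QReg (2 * 4)) :
    (leakCol a ha key)ᴴ * leakCol a ha key = bothProj (N := N) a ha := by
  ext x y
  rw [Matrix.mul_apply, bothProj, diagonal_apply]
  simp only [conjTranspose_apply, leakCol, of_apply]
  by_cases hx : Both a ha x
  · by_cases hxy : x = y
    · subst hxy
      rw [if_pos rfl, if_pos hx, Finset.sum_eq_single (splice x a key)]
      · simp [hx]
      · intro r _ hr; rw [if_neg (fun h => hr h.2)]; simp
      · intro h; exact absurd (Finset.mem_univ _) h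
    · rw [if_neg hxy]
      refine Finset.sum_eq_zero fun r _ => ?_
      by_cases h1 : Both a ha x ∧ r = splice x a key
      · by_cases h2 : Both a ha y ∧ r = splice y a key
        · exact absurd (eq_of_splice_eq ha hx h2.1 (h1.2.symm.trans h2.2)) hxy
        · rw [if_neg h2, mul_zero]
      · rw [if_neg h1]; simp
  · have h0 : ∀ r, ¬(Both a ha x ∧ r = splice x a key) := fun r h => hx h.1
    simp only [h0, if_false, star_zero, zero_mul, Finset.sum_const_zero]
    by_cases hxy : x = y
    · subst hxy; rw [if_pos rfl, if_neg hx]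
    · rw [if_neg hxy]

/-- `‖Lᵢ‖ ≤ 1`. [folklore] -/
theorem norm_leakCol_le_one (a : ℕ) (ha : a + 2 ≤ N) (key : QReg (2 * 4)) : ‖leakCol (N := N) a ha key‖ ≤ 1 := by
  have e := Matrix.l2_opNorm_conjTranspose_mul_self (leakCol (N := N) a ha key)
  rw [conjTranspose_leakCol_mul_self] at e
  have h1 := norm_bothProj_le_one (N := N) a ha
  nlinarith [norm_nonneg (leakCol (N := N) a ha key), norm_nonneg (bothProj (N := N) a ha)]

/-- `‖Σ cᵢ Lᵢ‖ ≤ Σ ‖cᵢ‖`. [folklore] -/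
theorem norm_leakMat_le (a : ℕ) (ha : a + 2 ≤ N) (L : SVec (2 * 4)) :
    ‖leakMat (N := N) a ha L‖ ≤ (L.map fun t => ‖K5.toComplex t.2‖).sum := by
  induction L with
  | nil => simp [leakMat]
  | cons t L ih =>
    have e : leakMat (N := N) a ha (t :: L) = K5.toComplex t.2 • leakCol a ha t.1 + leakMat a ha L := by
      simp [leakMat]
    rw [e, List.map_cons, List.sum_cons]
    refine le_trans (norm_add_le _ _) (add_le_add ?_ ih)
    refine le_trans (norm_smul_le _ _) ?_
    calc ‖K5.toComplex t.2‖ * ‖leakCol (N := N) a ha t.1‖ ≤ ‖K5.toComplex t.2‖ * 1 :=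
          mul_le_mul_of_nonneg_left (norm_leakCol_le_one a ha t.1) (norm_nonneg _)
      _ = ‖K5.toComplex t.2‖ := mul_one _

/-- `‖z‖² = Re (z · conj z)` in the form used for `K5` numbers. [folklore] -/
theorem norm_sq_toComplex (c : K5) : ‖K5.toComplex c‖ ^ 2 = (K5.toComplex (c * K5.cconj c)).re := by
  rw [map_mul, K5.toComplex_cconj, Complex.mul_conj, ← Complex.normSq_eq_norm_sq]; simp

/-- **The leakage coefficients have modulus `≤ 1`**: `|cᵢ|² ∈ {7φ-11, 18-11φ, 18φ-29}`.
[cite: AharonovArad2011, §3.2] -/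
theorem norm_leakS_coeff_le_one : ∀ t ∈ leakS, ‖K5.toComplex t.2‖ ≤ 1 := by
  have hφ1 : Real.goldenRatio < 13 / 8 := by
    rw [Real.goldenRatio]
    have : Real.sqrt 5 < 9 / 4 := by
      rw [Real.sqrt_lt' (by norm_num)]; norm_num
    linarith
  have hφ2 : 8 / 5 < Real.goldenRatio := by
    rw [Real.goldenRatio]
    have : (11 : ℝ) / 5 < Real.sqrt 5 := by
      rw [Real.lt_sqrt (by norm_num)]; norm_num
    linarith
  have key : ∀ c : K5, ∀ v : ZPhi, c * K5.cconj c = K5.ofPhi v → ZPhi.toReal v ≤ 1 → ‖K5.toComplex c‖ ≤ 1 := by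
    intro c v hc hv
    have h2 : ‖K5.toComplex c‖ ^ 2 ≤ 1 := by
      rw [norm_sq_toComplex, hc, K5.toComplex_ofPhi, Complex.ofReal_re]; exact hv
    nlinarith [norm_nonneg (K5.toComplex c)]
  intro t ht
  simp only [leakS, List.mem_cons, List.mem_nil_iff, or_false] at ht
  rcases ht with rfl | rfl | rfl | rfl
  · refine key _ ⟨-11, 7⟩ (by decide) ?_
    rw [ZPhi.toReal_apply]; change ((-11 : ℤ) : ℝ) + ((7 : ℤ) : ℝ) * Real.goldenRatio ≤ 1; push_cast; linarith
  · refine key _ ⟨18, -11⟩ (by decide) ?_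
    rw [ZPhi.toReal_apply]; change ((18 : ℤ) : ℝ) + ((-11 : ℤ) : ℝ) * Real.goldenRatio ≤ 1; push_cast; linarith
  · refine key _ ⟨-29, 18⟩ (by decide) ?_
    rw [ZPhi.toReal_apply]; change ((-29 : ℤ) : ℝ) + ((18 : ℤ) : ℝ) * Real.goldenRatio ≤ 1; push_cast; linarith
  · refine key _ ⟨18, -11⟩ (by decide) ?_
    rw [ZPhi.toReal_apply]; change ((18 : ℤ) : ℝ) + ((-11 : ℤ) : ℝ) * Real.goldenRatio ≤ 1; push_cast; linarith

/-- `‖L‖ ≤ 4` for the leakage part. [cite: AharonovArad2011, §3.2] -/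
theorem norm_leakMat_leakS_le (a : ℕ) (ha : a + 2 ≤ N) : ‖leakMat (N := N) a ha leakS‖ ≤ 4 := by
  refine le_trans (norm_leakMat_le a ha leakS) ?_
  have h := norm_leakS_coeff_le_one
  simp only [leakS, List.mem_cons, List.mem_nil_iff, or_false, forall_eq_or_imp, forall_eq, List.map_cons,
    List.map_nil, List.sum_cons, List.sum_nil] at h ⊢
  linarith [h.1, h.2.1, h.2.2.1, h.2.2.2]

/-- **The gadget defect bound**: `‖bigOp a g · encIso - encIso · ctrlPhase a u‖ ≤ ‖p(g) - u‖ + 4 ‖q(g)‖`.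
[cite: AharonovArad2011, §3.2, Claim 3.1] -/
theorem norm_bigOp_mul_encIso_sub_le (a : ℕ) (ha : a + 2 ≤ N) (g : List Sym) (u : ℂ) :
    ‖bigOp a ha g * encIso N - encIso N * ctrlPhase a ha u‖ ≤
      ‖K5.toComplex (piVec g).1 - u‖ + 4 * ‖K5.toComplex (piVec g).2‖ := by
  rw [bigOp_mul_encIso_sub a ha g u]
  refine le_trans (norm_add_le _ _) (add_le_add ?_ ?_)
  · refine le_trans (norm_smul_le _ _) ?_
    have h1 : ‖encIso N * bothProj a ha‖ ≤ 1 :=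
      calc ‖encIso N * bothProj a ha‖ ≤ ‖encIso N‖ * ‖bothProj a ha‖ := Matrix.l2_opNorm_mul _ _
        _ ≤ 1 * 1 := mul_le_mul (norm_le_one_of_isometry conjTranspose_encIso_mul_encIso)
            (norm_bothProj_le_one a ha) (norm_nonneg _) zero_le_one
        _ = 1 := mul_one _
    calc ‖K5.toComplex (piVec g).1 - u‖ * ‖encIso N * bothProj a ha‖ ≤ ‖K5.toComplex (piVec g).1 - u‖ * 1 :=
          mul_le_mul_of_nonneg_left h1 (norm_nonneg _)
      _ = _ := mul_one _
  · refine le_trans (norm_smul_le _ _) ?_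
    rw [mul_comm]
    exact mul_le_mul_of_nonneg_right (norm_leakMat_leakS_le a ha) (norm_nonneg _)

end Gadget

end Literature.Computability.QuantumComplexity

end
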